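import Literature.Probability.LatticeModels.FKIsingRSWFirstMoment
import HarnessLib

/-!
# RSW for the critical FK-Ising model from a summed two-point bound on the half-rectangle

Topic `Literature/Probability/LatticeModels`; part of the discharge programme for the named fact
`fkIsing_rsw` (`FKIsingRSW.lean`: Duminil-Copin–Hongler–Nolin 2011, Thm. 1 for free boundary
conditions = Duminil-Copin–Smirnov 2012, Thm. 3.16). Theorems only; no definition of a notion, no
named fact.

`FKIsingRSWSecondMoment.lean` reduces `fkIsing_rsw` to DCHN's Proposition 13 (`h13`, the first
moment) and to a *pointwise* form of Proposition 14 with Lemma 15 (`h14`: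
`φ^{side}_H(a ↔ side, b ↔ side) ≤ C/√((|a₁ - b₁| + 1) n)` on the half `H = [0, 2n] × [0, n]` with its
far side wired), and `FKIsingRSWFirstMoment.lean` proves `h13`
(`LatticeDobrushin.fkIsing_connection_lower_bound`). The second-moment method (DCHN 2011, §4, proof
of Thm. 1, Step 1: `E⁰[N_n²] ≤ (Σ_{x,y} φ^{side}_H(x', y' ↔ side)) (Σ_{u,v} φ^{side}_H(u', v' ↔ side))`)
only ever uses the **sum** of the two-point probabilities over the free side. This file records
that weaker, summed hypothesis as the single remaining input:

* `fkIsing_rsw_of_pair_sum`: if there is `C` with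
  `Σ_{i,j = 0}^{n} φ^{side}_H((0,i) ↔ side, (0,j) ↔ side) ≤ C n` for all `n ≥ 1`, then `fkIsing_rsw`.

Proof: the first moment exactly as in `fkIsing_rsw_of_connection_bounds` with `h13` supplied by
`LatticeDobrushin.fkIsing_connection_lower_bound`; for the second moment, each term
`φ⁰_R(x ↔ u, y ↔ v)` is bounded by the product of the two half-rectangle probabilities
(`fkIsingFiniteMeasure_real_openConnIn_inter_le_mul`, DCHN's domain-Markov/FKG/symmetry step),
the double sum over pairs of pairs factors (`sum_product_sum_product_mul`), and each factor is a
sum over a side of `R`, reindexed by the second coordinate (`sum_columnSites_eq_sum_range`), i.e.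
the hypothesis. The sites `(0, i)` of the free side are `sideSite n i` (clamped to `i ≤ n` so that
the map is total).

## References

* H. Duminil-Copin, C. Hongler, P. Nolin, *Connection probabilities and RSW-type bounds for the
  two-dimensional FK Ising model*, Comm. Pure Appl. Math. 64 (2011) 1165–1198 (arXiv:0912.4253),
  §4, proof of Thm. 1, Step 1. [DuminilCopinHonglerNolin2011]
* H. Duminil-Copin, S. Smirnov, *Conformal invariance of lattice models*, Clay Math. Proc. 15
  (2012), Thm. 3.16 and §7.2. [DuminilCopinSmirnov2012Clay]
-/

noncomputable section

namespace Literature.Probability.LatticeModels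

open MeasureTheory Finset SimpleGraph
open Literature.Probability.Percolation

/-! ### The sites of the free side of the half-rectangle -/

section SideSites

variable (n : ℕ)

/-- The site `(0, min i n)` of the free side `{x₀ = 0}` of the half-rectangle `[0, 2n] × [0, n]`
(clamped, so that `sideSite n` is a total function of `i : ℕ`). [folklore] -/
def sideSite (i : ℕ) : ↥(rectangle (2 * n) n) :=
  ⟨![0, ((min i n : ℕ) : ℤ)], by
    rw [mem_rectangle_iff]
    simp only [Matrix.cons_val_zero, Matrix.cons_val_one]
    refine ⟨le_rfl, by positivity, by positivity, ?_⟩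
    exact_mod_cast min_le_right i n⟩

/-- The underlying site of `sideSite n i`. [folklore] -/
@[simp] theorem sideSite_coe (i : ℕ) : (sideSite n i : Site 2) = ![0, ((min i n : ℕ) : ℤ)] := rfl

/-- For `i ≤ n` the site `sideSite n i` is `(0, i)`. [folklore] -/
theorem sideSite_coe_of_le {i : ℕ} (hi : i ≤ n) : (sideSite n i : Site 2) = ![0, (i : ℤ)] := by
  rw [sideSite_coe, min_eq_left hi]

/-- `sideSite n i` lies on the free side. [folklore] -/
theorem sideSite_apply_zero (i : ℕ) : (sideSite n i).1 0 = 0 := rfl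

/-- A left-side site `x` of `R = [0, 4n] × [0, n]`, seen in the half, is `sideSite n (x₁)`. [folklore] -/
theorem toHalfLeft_eq_sideSite {x : ↥(↑(rectangle (4 * n) n) : Set (Site 2))} (hx : x.1 0 = 0) :
    toHalfLeft x hx = sideSite n (x.1 1).toNat := by
  obtain ⟨-, -, h1, h1'⟩ := mem_rectangle_iff.1 (Finset.mem_coe.1 x.2)
  have hle : (x.1 1).toNat ≤ n := by rw [Int.toNat_le]; exact h1'
  refine Subtype.ext ?_
  change x.1 = _
  rw [sideSite_coe_of_le n hle]
  ext k
  fin_cases k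
  · simp [hx]
  · simp [Int.toNat_of_nonneg h1]

/-- A right-side site `u` of `R`, reflected into the half, is `sideSite n (u₁)`. [folklore] -/
theorem toHalfRight_eq_sideSite {u : ↥(↑(rectangle (4 * n) n) : Set (Site 2))}
    (hu : u.1 0 = ((4 * n : ℕ) : ℤ)) : toHalfRight u hu = sideSite n (u.1 1).toNat := by
  obtain ⟨-, -, h1, h1'⟩ := mem_rectangle_iff.1 (Finset.mem_coe.1 u.2)
  have hle : (u.1 1).toNat ≤ n := by rw [Int.toNat_le]; exact h1'
  refine Subtype.ext ?_
  change rswMirror n u.1 = _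
  rw [sideSite_coe_of_le n hle]
  ext k
  fin_cases k
  · simp [rswMirror_apply_zero, hu]
  · simp [rswMirror_apply_one, Int.toNat_of_nonneg h1]

end SideSites

/-! ### The reduction -/

section Assembly

/-- **RSW for the critical FK-Ising model from a summed two-point bound on the half-rectangle**
(DCHN 2011, §4, proof of Thm. 1, Step 1, with Prop. 13 supplied by
`LatticeDobrushin.fkIsing_connection_lower_bound`). If there is a constant `C` such that for all
`n ≥ 1`, on the half `H = [0, 2n] × [0, n]` with its far side `{x₀ = 2n}` wired,
`Σ_{i=0}^{n} Σ_{j=0}^{n} φ^{side}_H((0,i) ↔ side, (0,j) ↔ side) ≤ C · n`, then `fkIsing_rsw` holds: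
`E⁰[N_n²] = Σ φ⁰_R(x ↔ u, y ↔ v) ≤ (Σ_{i,j} φ^{side}_H(·))² ≤ (C n)²`, `E⁰[N_n] ≥ c n` (Prop. 13
summed over the middle windows), and Cauchy–Schwarz (`fkIsing_rsw_of_pairCount_moments`). This
summed form is all that DCHN's argument uses of their Prop. 14 / Lemma 15.
[cite: DuminilCopinHonglerNolin2011, §4, proof of Thm. 1, Step 1] -/
theorem fkIsing_rsw_of_pair_sum
    (hsum : ∃ C : ℝ, ∀ n : ℕ, 1 ≤ n →
      ∑ i ∈ Finset.range (n + 1), ∑ j ∈ Finset.range (n + 1),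
        (fkIsingFiniteMeasure (rectangle (2 * n) n) (halfWiredSide n)).real
          (halfConn n (sideSite n i) ∩ halfConn n (sideSite n j)) ≤ C * n) :
    fkIsing_rsw := by
  obtain ⟨c, hc, h13⟩ := LatticeDobrushin.fkIsing_connection_lower_bound
  obtain ⟨C, hsum⟩ := hsum
  -- `C ≥ 0` (test the hypothesis at `n = 1`)
  have hC0 : 0 ≤ C := by
    have h := hsum 1 le_rfl
    have h0 : 0 ≤ ∑ i ∈ Finset.range (1 + 1), ∑ j ∈ Finset.range (1 + 1),
        (fkIsingFiniteMeasure (rectangle (2 * 1) 1) (halfWiredSide 1)).real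
          (halfConn 1 (sideSite 1 i) ∩ halfConn 1 (sideSite 1 j)) :=
      Finset.sum_nonneg fun i _ ↦ Finset.sum_nonneg fun j _ ↦ measureReal_nonneg
    simp only [Nat.cast_one, mul_one] at h
    linarith
  have hp₁ := real_openConnIn_corners_pos 1
  set p₁ : ℝ := (fkIsingFiniteMeasure (rectangle (4 * 1) 1) ∅).real
    (openConnIn Set.univ (cornerLeft 1) (cornerRight 1)) with hp₁def
  refine fkIsing_rsw_of_pairCount_moments ⟨min (c / 16) p₁, lt_min (by positivity) hp₁, ?_⟩
    ⟨C ^ 2, ?_⟩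
  · -- the first moment (verbatim from `fkIsing_rsw_of_connection_bounds`)
    intro n hn
    rw [integral_rswPairCount]
    have hnonneg : ∀ xy ∈ rswPairs n,
        0 ≤ (fkIsingFiniteMeasure (rectangle (4 * n) n) ∅).real (openConnIn Set.univ xy.1 xy.2) :=
      fun xy _ ↦ measureReal_nonneg
    by_cases hn1 : n = 1
    · subst hn1
      have hmem : (cornerLeft 1, cornerRight 1) ∈ rswPairs 1 := by
        rw [mem_rswPairs]; exact ⟨rfl, rfl⟩
      have hle := Finset.single_le_sum hnonneg hmem
      calc min (c / 16) p₁ * ((1 : ℕ) : ℝ) = min (c / 16) p₁ := by simp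
        _ ≤ p₁ := min_le_right _ _
        _ ≤ ∑ xy ∈ rswPairs 1,
              (fkIsingFiniteMeasure (rectangle (4 * 1) 1) ∅).real (openConnIn Set.univ xy.1 xy.2) :=
            hle
    · have hn2 : 2 ≤ n := by omega
      have hsub : windowSites n 0 ×ˢ windowSites n ((4 * n : ℕ) : ℤ) ⊆ rswPairs n := by
        rw [rswPairs_eq_product]
        exact Finset.product_subset_product (Finset.filter_subset _ _) (Finset.filter_subset _ _)
      have hW0 := le_four_mul_card_windowSites n (a := 0) ⟨le_rfl, by positivity⟩ hn2
      have hW1 := le_four_mul_card_windowSites n (a := ((4 * n : ℕ) : ℤ))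
        ⟨by positivity, by push_cast; exact le_rfl⟩ hn2
      have hn0 : (0 : ℝ) < n := by exact_mod_cast hn
      calc min (c / 16) p₁ * n ≤ c / 16 * n := mul_le_mul_of_nonneg_right (min_le_left _ _) hn0.le
        _ ≤ ((windowSites n 0).card * (windowSites n ((4 * n : ℕ) : ℤ)).card : ℕ) * (c / n) := by
            have h0 : (n : ℝ) ≤ 4 * (windowSites n 0).card := by exact_mod_cast hW0
            have h1 : (n : ℝ) ≤ 4 * (windowSites n ((4 * n : ℕ) : ℤ)).card := by exact_mod_cast hW1
            have hcn : 0 ≤ c / n := by positivity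
            calc c / 16 * n = ((n : ℝ) * n / 16) * (c / n) := by field_simp
              _ ≤ ((windowSites n 0).card * (windowSites n ((4 * n : ℕ) : ℤ)).card : ℕ) * (c / n) := by
                  refine mul_le_mul_of_nonneg_right ?_ hcn
                  rw [Nat.cast_mul]
                  have hprod := mul_le_mul h0 h1 hn0.le (by positivity)
                  linarith [hprod]
        _ = ∑ xy ∈ windowSites n 0 ×ˢ windowSites n ((4 * n : ℕ) : ℤ), c / n := by
            rw [Finset.sum_const, Finset.card_product, nsmul_eq_mul]
        _ ≤ ∑ xy ∈ windowSites n 0 ×ˢ windowSites n ((4 * n : ℕ) : ℤ),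
              (fkIsingFiniteMeasure (rectangle (4 * n) n) ∅).real (openConnIn Set.univ xy.1 xy.2) := by
            refine Finset.sum_le_sum fun xy hxy ↦ ?_
            rw [Finset.mem_product, mem_windowSites, mem_windowSites] at hxy
            exact h13 n hn xy.1 xy.2 hxy.1.1 hxy.2.1 hxy.1.2.1 hxy.1.2.2 hxy.2.2.1 hxy.2.2.2
        _ ≤ ∑ xy ∈ rswPairs n,
              (fkIsingFiniteMeasure (rectangle (4 * n) n) ∅).real (openConnIn Set.univ xy.1 xy.2) :=
            Finset.sum_le_sum_of_subset_of_nonneg hsub fun xy hxy _ ↦ hnonneg xy hxy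
  · -- the second moment
    intro n hn
    have hn0 : (0 : ℝ) < n := by exact_mod_cast hn
    rw [integral_rswPairCount_sq]
    -- the half-rectangle two-point probability as an (opaque) function of the second coordinates
    obtain ⟨g, hg⟩ : ∃ g : ℤ → ℤ → ℝ, ∀ s t : ℤ, g s t =
        (fkIsingFiniteMeasure (rectangle (2 * n) n) (halfWiredSide n)).real
          (halfConn n (sideSite n s.toNat) ∩ halfConn n (sideSite n t.toNat)) :=
      ⟨_, fun _ _ ↦ rfl⟩
    have hg0 : ∀ s t : ℤ, 0 ≤ g s t := fun s t ↦ by rw [hg]; exact measureReal_nonneg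
    -- the bound for one pair of pairs
    have hpair : ∀ xy ∈ rswPairs n, ∀ xy' ∈ rswPairs n,
        (fkIsingFiniteMeasure (rectangle (4 * n) n) ∅).real
            (openConnIn Set.univ xy.1 xy.2 ∩ openConnIn Set.univ xy'.1 xy'.2) ≤
          g (xy.1.1 1) (xy'.1.1 1) * g (xy.2.1 1) (xy'.2.1 1) := by
      intro xy hxy xy' hxy'
      rw [mem_rswPairs] at hxy hxy'
      have key := fkIsingFiniteMeasure_real_openConnIn_inter_le_mul
        (x := xy.1) (y := xy'.1) (u := xy.2) (v := xy'.2)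
        (x' := toHalfLeft xy.1 hxy.1) (y' := toHalfLeft xy'.1 hxy'.1)
        (u' := toHalfRight xy.2 hxy.2) (v' := toHalfRight xy'.2 hxy'.2)
        (Subtype.ext rfl) (Subtype.ext rfl) (Subtype.ext (rswMirror_rswMirror n _))
        (Subtype.ext (rswMirror_rswMirror n _))
      rw [toHalfLeft_eq_sideSite n hxy.1, toHalfLeft_eq_sideSite n hxy'.1,
        toHalfRight_eq_sideSite n hxy.2, toHalfRight_eq_sideSite n hxy'.2, ← hg, ← hg] at key
      exact key
    -- the sum over one side is the hypothesis
    have hside : ∀ {a : ℤ}, 0 ≤ a ∧ a ≤ 4 * n →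
        ∑ x ∈ columnSites n a, ∑ y ∈ columnSites n a, g (x.1 1) (y.1 1) ≤ C * n := by
      intro a ha
      have h1 : ∀ x ∈ columnSites n a, ∑ y ∈ columnSites n a, g (x.1 1) (y.1 1) =
          ∑ j ∈ Finset.range (n + 1), g (x.1 1) j :=
        fun x _ ↦ sum_columnSites_eq_sum_range n ha (g (x.1 1))
      rw [Finset.sum_congr rfl h1,
        sum_columnSites_eq_sum_range n ha (fun s ↦ ∑ j ∈ Finset.range (n + 1), g s j)]
      have h2 : ∀ i ∈ Finset.range (n + 1), ∑ j ∈ Finset.range (n + 1), g i j =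
          ∑ j ∈ Finset.range (n + 1),
            (fkIsingFiniteMeasure (rectangle (2 * n) n) (halfWiredSide n)).real
              (halfConn n (sideSite n i) ∩ halfConn n (sideSite n j)) :=
        fun i _ ↦ Finset.sum_congr rfl fun j _ ↦ by rw [hg, Int.toNat_natCast, Int.toNat_natCast]
      rw [Finset.sum_congr rfl h2]
      exact hsum n hn
    have step1 : (∑ xy ∈ rswPairs n, ∑ xy' ∈ rswPairs n,
        (fkIsingFiniteMeasure (rectangle (4 * n) n) ∅).real
          (openConnIn Set.univ xy.1 xy.2 ∩ openConnIn Set.univ xy'.1 xy'.2)) ≤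
        ∑ xy ∈ rswPairs n, ∑ xy' ∈ rswPairs n,
          g (xy.1.1 1) (xy'.1.1 1) * g (xy.2.1 1) (xy'.2.1 1) :=
      Finset.sum_le_sum fun xy hxy ↦ Finset.sum_le_sum fun xy' hxy' ↦ hpair xy hxy xy' hxy'
    have step2 : (∑ xy ∈ rswPairs n, ∑ xy' ∈ rswPairs n,
          g (xy.1.1 1) (xy'.1.1 1) * g (xy.2.1 1) (xy'.2.1 1)) =
        (∑ x ∈ columnSites n 0, ∑ y ∈ columnSites n 0, g (x.1 1) (y.1 1)) *
          ∑ u ∈ columnSites n ((4 * n : ℕ) : ℤ), ∑ v ∈ columnSites n ((4 * n : ℕ) : ℤ),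
            g (u.1 1) (v.1 1) := by
      rw [rswPairs_eq_product]
      exact sum_product_sum_product_mul (columnSites n 0) (columnSites n ((4 * n : ℕ) : ℤ))
        (fun x y ↦ g (x.1 1) (y.1 1)) (fun u v ↦ g (u.1 1) (v.1 1))
    have step3 : (∑ x ∈ columnSites n 0, ∑ y ∈ columnSites n 0, g (x.1 1) (y.1 1)) *
          ∑ u ∈ columnSites n ((4 * n : ℕ) : ℤ), ∑ v ∈ columnSites n ((4 * n : ℕ) : ℤ),
            g (u.1 1) (v.1 1) ≤ (C * n) * (C * n) :=
      mul_le_mul (hside ⟨le_rfl, by positivity⟩)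
        (hside ⟨by positivity, by push_cast; exact le_rfl⟩)
        (Finset.sum_nonneg fun u _ ↦ Finset.sum_nonneg fun v _ ↦ hg0 _ _)
        (mul_nonneg hC0 hn0.le)
    calc (∑ xy ∈ rswPairs n, ∑ xy' ∈ rswPairs n,
        (fkIsingFiniteMeasure (rectangle (4 * n) n) ∅).real
          (openConnIn Set.univ xy.1 xy.2 ∩ openConnIn Set.univ xy'.1 xy'.2))
        ≤ (C * n) * (C * n) := step1.trans (step2.le.trans step3)
      _ = C ^ 2 * (n : ℝ) ^ 2 := by ring

end Assembly

end Literature.Probability.LatticeModels
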